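import Literature.NumberTheory.Automorphic.JacquetCuspidalCompactCoefficients   -- ★ one-ray engine: `span_level_mono`, `exists_mem_span_level_of_mem_coinvariantsKer`, `apply_pow_apply_eq_zero_of_mem_span_level`, `coinvariantsKer_eq_top_of_subsingleton`
import Mathlib.Data.Finset.NoncommProd
import HarnessLib

/-!
# Harish-Chandra's support theorem over a CONE of contracting directions: a smooth representation all of whose (maximal proper)
# Jacquet modules vanish has compactly supported matrix coefficients, GIVEN a Cartan-type exhaustion over a dominant cone
# (Bernstein–Zelevinsky 1976 §3.18–3.21; Casselman 1995 Thm. 5.3.1 — ANY RANK)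

Topic `NumberTheory/Automorphic`; namespace `Representation` (dot-notation extensions, as in ★ `JacquetCuspidalCompactCoefficients`).  THEOREMS
ONLY: no definition, no named fact, no instance, no notation, no `sorry`.  Cell `hodgecm-mathlib`, Track B «K2-LIT», line K2_E3 (item
`stmt-HodgeConjecture-24833`), road J7 of the 13a letter `sig_K2E3LocalIrrepAdmissible` («irreducible smooth ⇒ admissible» for `U_N(H)(L⁺_v)`, all `N`;
MEMO `K2/K2E3-p13/g0/MEMO-13a-admissibility-generalN.md`): the ★ one-ray engine `Representation.isSupercuspidal_of_subsingleton_coinvariants_of_cartan`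
exhausts `G = K₀ aℕ K₀ Z(G)` by ONE contracting element, which is a Cartan decomposition only in split rank one; this file is the SAME argument
over a dominant CONE (any rank).  HONEST SCOPE: no structure theory is supplied here (the cone, the contraction data and the Cartan exhaustion are
hypotheses); HC_CM is proved only modulo its printed citations until rung 0 closes.

THE MATHEMATICS ([Casselman1995, Thm. 5.3.1]; [BernsteinZelevinsky1976, 3.18–3.21] for `GL_n`).  `G` a topological group, `π` a SMOOTH
representation on `V`.  DIRECTIONS `α ∈ ι` (finite; the simple roots): for each `α` a subgroup `N_α` (the unipotent radical of the maximal proper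
parabolic `P_α`) along which `π` is Jacquet-cuspidal (`V = V(N_α)`), a level filtration `(N_{α,j})_{j ∈ ℤ}` of `N_α` (increasing, exhausting,
shrinking to `1`) and an element `a_α` CONTRACTING it (`a_α N_{α,j+1} a_α⁻¹ ≤ N_{α,j}`).  DOMINANT SET `M ⊆ G` (the cone `A⁺ = {∏ a_α^{n_α}}`): every
`m ∈ M` PRESERVES every level (`m N_{α,j} m⁻¹ ≤ N_{α,j}`).  CARTAN: `G = K₀ · M · K₀ · Z(G)` with `K₀` compact, and DEPTH: for every `n₀`, every
`m ∈ M` is either in a compact exceptional set `F(n₀)` or `n₀`-DEEP in some direction, `m = a_α^n m'` with `n ≥ n₀`, `m' ∈ M` (for the cone: the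
monomials with all exponents `< n₀` are finitely many).  THEN every smooth matrix coefficient vanishes at `k₁ a_α^n m' k₂ z` for `n ≥ n₀(α)` —
`π(m' z k₂) w` stays in ONE level span of `N_α` (dominance; finiteness of the `K₀`-orbits of `w` and `φ`), which `a_α^n` contracts into the stabiliser
of `φ` — so its support lies in `K₀ F(n₀) K₀ · Z(G)`: `π` is supercuspidal (compact-mod-centre coefficients, ★ `Representation.IsSupercuspidal`).

* §1 `apply_mem_span_level_of_conj_mem` (level spans are stable under LEVEL-PRESERVING elements — the dominance replacement of ★ `…_of_comm`);
  `exists_forall_apply_conj_pow_mul_apply_eq_zero` (uniform vanishing at `k₁ a^n m k₂ z`, `m` dominant, `n ≥ n₀`).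
* §2 **`isSupercuspidal_of_coinvariantsKer_eq_top_of_cartan_cone`** (abstract dominant set `M`) and its parabolic-triple packaging
  **`isSupercuspidal_of_subsingleton_coinvariants_of_cartan_cone`** (`Subsingleton (t_α.restrict π).Coinvariants` for each `α`).
* §3 the CONE instance **`isSupercuspidal_of_subsingleton_coinvariants_of_cartan_pi`**: pairwise commuting `a : ι → G`, each `a_β` preserving every
  `N_{α,j}`, `M = {∏_α a_α^{n_α}}` (`Finset.noncommProd`), Cartan `G = K₀ · {∏ a^n} · K₀ · Z(G)` — the shape the unitary groups `U_N(H)(L⁺_v)` of Witt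
  index `r` supply with `ι = Fin r` (rank one: ★ `exists_cartan_of_involution`).

## References
* [Casselman1995] W. Casselman, *Introduction to the theory of admissible representations of `p`-adic reductive groups* (draft 1 May 1995), Prop. 1.4.3,
  Thm. 5.3.1 (any rank), §5.4.
* [BernsteinZelevinsky1976] I. N. Bernstein, A. V. Zelevinsky, *Representations of the group `GL(n, F)` where `F` is a non-archimedean local field*,
  Russian Math. Surveys 31:3 (1976) 1–68: §3.18–3.21.
* [HarishChandra1970] Harish-Chandra (notes by G. van Dijk), *Harmonic analysis on reductive `p`-adic groups*, LNM 162 (1970): Part I §3.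
-/

set_option autoImplicit false

noncomputable section

open scoped Pointwise Function

namespace Representation

open Literature.NumberTheory.Automorphic Literature.NumberTheory.Automorphic.JacquetLemma

section Algebraic

variable {k G V : Type*} [Field k] [Group G] [AddCommGroup V] [Module k V] (π : Representation k G V)

/-! ## §1 Level spans under dominant elements; the uniform vanishing -/

/-- `φ (π(g) y) = (π^*(g⁻¹) φ) y`. [folklore] -/
private theorem apply_apply_eq_dual_apply_of_inv' (φ : Module.Dual k V) (g : G) (y : V) :
    φ (π g y) = π.dual g⁻¹ φ y := by
  rw [dual_apply, inv_inv, Module.Dual.transpose_apply, LinearMap.comp_apply]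

/-- **Level spans are stable under level-preserving elements**: if `z N_J z⁻¹ ≤ N_J` then `π(z)` maps `span {π(u) y − y : u ∈ N_J}` into itself
(`π(z)(π(u) y − y) = π(z u z⁻¹)(π(z) y) − π(z) y`) — the DOMINANCE form of ★ `apply_mem_span_level_of_comm`. [cite: Casselman1995, Prop. 1.4.3; Thm. 5.3.1]
[cite: BernsteinZelevinsky1976, §3.18–3.21] -/
theorem apply_mem_span_level_of_conj_mem (Nf : ℤ → Subgroup G) (J : ℤ) {z : G} (hz : ∀ u ∈ Nf J, z * u * z⁻¹ ∈ Nf J) {w : V}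
    (hw : w ∈ Submodule.span k {y | ∃ u ∈ Nf J, ∃ v : V, y = π u v - v}) :
    π z w ∈ Submodule.span k {y | ∃ u ∈ Nf J, ∃ v : V, y = π u v - v} := by
  induction hw using Submodule.span_induction with
  | mem y hy =>
    obtain ⟨u, hu, v, rfl⟩ := hy
    refine Submodule.subset_span ⟨z * u * z⁻¹, hz u hu, π z v, ?_⟩
    rw [map_sub, ← Module.End.mul_apply, ← map_mul, ← Module.End.mul_apply (π (z * u * z⁻¹)), ← map_mul, inv_mul_cancel_right]
  | zero => rw [map_zero]; exact Submodule.zero_mem _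
  | add x y _ _ hx hy => rw [map_add]; exact Submodule.add_mem _ hx hy
  | smul c x _ hx => rw [map_smul]; exact Submodule.smul_mem _ c hx

end Algebraic

section Topological

variable {k G V : Type*} [Field k] [Group G] [TopologicalSpace G] [IsTopologicalGroup G]
  [AddCommGroup V] [Module k V] (π : Representation k G V)

/-- **Uniform vanishing behind a dominant element** [BZ76 3.19; Casselman Thm. 5.3.1]: `π` smooth and Jacquet-cuspidal along `N` (every vector in
`V(N)`), `(N_j)` increasing, exhausting `N`, shrinking to `1`, contracted by `a` and PRESERVED by every element of `M`; `K₀` a subgroup inside a compact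
set.  Then for a smooth linear form `φ` and any `w` there is `n₀` with `φ (π(k₁ · aⁿ m · k₂ z) w) = 0` for all `k₁, k₂ ∈ K₀`, `m ∈ M`, central `z`,
`n ≥ n₀`: the `K₀`-orbits of `φ` and `w` are finite (★ `finite_orbit_of_isSmoothVector`), `π(m)`, `π(z)` preserve the level of `π(k₂) w` (§1), and
`aⁿ` contracts that level into the stabiliser of `π^*(k₁⁻¹) φ` (★ `apply_pow_apply_eq_zero_of_mem_span_level`). [cite: Casselman1995, Thm. 5.3.1]
[cite: BernsteinZelevinsky1976, §3.18–3.21] -/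
theorem exists_forall_apply_conj_pow_mul_apply_eq_zero (hπ : π.IsSmooth) (N : Subgroup G)
    (hker : Coinvariants.ker (π.comp N.subtype) = ⊤)
    (Nf : ℤ → Subgroup G) (hmono : ∀ j : ℤ, Nf j ≤ Nf (j + 1)) (hexh : ∀ u ∈ N, ∃ j : ℤ, u ∈ Nf j)
    (hsmall : ∀ U ∈ nhds (1 : G), ∃ j : ℤ, (Nf j : Set G) ⊆ U)
    (a : G) (hcontr : ∀ j : ℤ, ∀ u ∈ Nf (j + 1), a * u * a⁻¹ ∈ Nf j)
    (M : Set G) (hdom : ∀ m ∈ M, ∀ j : ℤ, ∀ u ∈ Nf j, m * u * m⁻¹ ∈ Nf j)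
    (K₀ : Subgroup G) {C : Set G} (hC : IsCompact C) (hK₀C : (K₀ : Set G) ⊆ C)
    {φ : Module.Dual k V} (hφ : φ ∈ π.contragredient) (w : V) :
    ∃ n₀ : ℕ, ∀ n : ℕ, n₀ ≤ n → ∀ k₁ ∈ K₀, ∀ m ∈ M, ∀ k₂ ∈ K₀, ∀ z ∈ Subgroup.center G,
      φ (π (k₁ * (a ^ n * m) * k₂ * z) w) = 0 := by
  set Oφ : Set (Module.Dual k V) := (fun g : G => π.dual g φ) '' (K₀ : Set G) with hOφ
  set Ow : Set V := (fun g : G => π g w) '' (K₀ : Set G) with hOw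
  have hOφf : Oφ.Finite := finite_orbit_of_isSmoothVector π.dual K₀ hC hK₀C hφ
  have hOwf : Ow.Finite := finite_orbit_of_isSmoothVector π K₀ hC hK₀C (hπ w)
  -- the one-coefficient bound for every pair in the product of the orbits (vacuous bound outside)
  have hpair : ∀ x : Module.Dual k V × V, ∃ n₀ : ℕ, x ∈ Oφ ×ˢ Ow →
      ∀ n : ℕ, n₀ ≤ n → ∀ m ∈ M, ∀ z ∈ Subgroup.center G, x.1 (π (a ^ n) (π m (π z x.2))) = 0 := by
    rintro ⟨φ', w'⟩
    by_cases hx : (φ', w') ∈ Oφ ×ˢ Ow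
    · obtain ⟨⟨g, -, rfl⟩, -⟩ := hx
      have hφ' : π.dual g φ ∈ π.contragredient := π.contragredient.apply_mem_toSubmodule g hφ
      obtain ⟨j₀, hj₀⟩ := hsmall _ (((π.mem_contragredient _).1 hφ').mem_nhds (Subgroup.one_mem _))
      have hw' : w' ∈ Coinvariants.ker (π.comp N.subtype) := by rw [hker]; trivial
      obtain ⟨J, hJ⟩ := π.exists_mem_span_level_of_mem_coinvariantsKer N Nf hmono hexh hw'
      refine ⟨(J - j₀).toNat, fun _ n hn m hm z hz => ?_⟩
      refine π.apply_pow_apply_eq_zero_of_mem_span_level Nf hmono a hcontr hj₀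
        (π.apply_mem_span_level_of_conj_mem Nf J (hdom m hm J)
          (π.apply_mem_span_level_of_comm Nf J (fun u _ => ((Subgroup.mem_center_iff.1 hz) u).symm) hJ)) n (by omega)
    · exact ⟨0, fun h => absurd h hx⟩
  choose n₀ hn₀ using hpair
  refine ⟨(hOφf.prod hOwf).toFinset.sum n₀, fun n hn k₁ hk₁ m hm k₂ hk₂ z hz => ?_⟩
  have hmem : (π.dual k₁⁻¹ φ, π k₂ w) ∈ Oφ ×ˢ Ow := ⟨⟨k₁⁻¹, inv_mem hk₁, rfl⟩, ⟨k₂, hk₂, rfl⟩⟩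
  have hle : n₀ (π.dual k₁⁻¹ φ, π k₂ w) ≤ (hOφf.prod hOwf).toFinset.sum n₀ :=
    Finset.single_le_sum (f := n₀) (fun _ _ => Nat.zero_le _) ((Set.Finite.mem_toFinset _).2 hmem)
  have hkz : k₂ * z = z * k₂ := (Subgroup.mem_center_iff.1 hz) k₂
  rw [mul_assoc (k₁ * (a ^ n * m)) k₂ z, hkz, map_mul, map_mul, map_mul, map_mul, Module.End.mul_apply, Module.End.mul_apply,
    Module.End.mul_apply, Module.End.mul_apply, apply_apply_eq_dual_apply_of_inv']
  exact hn₀ _ hmem n (hle.trans hn) m hm z hz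

/-! ## §2 Compact support modulo the centre from a Cartan exhaustion over a dominant set -/

/-- **HARISH-CHANDRA'S SUPPORT THEOREM OVER A DOMINANT CONE, abstract form** [Casselman 1995 Thm. 5.3.1, any rank; BZ76 3.21].  `π` SMOOTH; finitely
many directions `α`, each with a subgroup `N α` along which `π` is Jacquet-cuspidal (`V = V(N α)`), a level filtration `Nf α` (increasing, exhausting,
shrinking to `1`) and a contracting element `a α`; a DOMINANT set `M` (each `m ∈ M` preserves every `Nf α j`); a compact subgroup `K₀` with the Cartan
exhaustion `G = K₀ · M · K₀ · Z(G)`; and DEPTH: for each `n₀`, every `m ∈ M` lies in a compact exceptional set `F` or is `m = (a α)^n m'` with `n ≥ n₀`,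
`m' ∈ M` for some `α`.  Then the smooth matrix coefficients of `π` are supported in `K₀ F K₀ · Z(G)`: `π.IsSupercuspidal`.
[cite: Casselman1995, Thm. 5.3.1] [cite: BernsteinZelevinsky1976, §3.18–3.21] [cite: HarishChandra1970, Part I §3] -/
theorem isSupercuspidal_of_coinvariantsKer_eq_top_of_cartan_cone (hπ : π.IsSmooth) {ι : Type*} [Finite ι]
    (N : ι → Subgroup G) (hker : ∀ α, Coinvariants.ker (π.comp (N α).subtype) = ⊤)
    (Nf : ι → ℤ → Subgroup G) (hmono : ∀ α (j : ℤ), Nf α j ≤ Nf α (j + 1)) (hexh : ∀ α, ∀ u ∈ N α, ∃ j : ℤ, u ∈ Nf α j)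
    (hsmall : ∀ α, ∀ U ∈ nhds (1 : G), ∃ j : ℤ, (Nf α j : Set G) ⊆ U)
    (a : ι → G) (hcontr : ∀ α (j : ℤ), ∀ u ∈ Nf α (j + 1), a α * u * (a α)⁻¹ ∈ Nf α j)
    (M : Set G) (hdom : ∀ m ∈ M, ∀ α (j : ℤ), ∀ u ∈ Nf α j, m * u * m⁻¹ ∈ Nf α j)
    (K₀ : Subgroup G) (hK₀ : IsCompact (K₀ : Set G))
    (hcartan : ∀ g : G, ∃ k₁ ∈ K₀, ∃ m ∈ M, ∃ k₂ ∈ K₀, ∃ z ∈ Subgroup.center G, g = k₁ * m * k₂ * z)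
    (hdeep : ∀ n₀ : ℕ, ∃ F : Set G, IsCompact F ∧
      ∀ m ∈ M, m ∈ F ∨ ∃ α, ∃ n : ℕ, n₀ ≤ n ∧ ∃ m' ∈ M, m = a α ^ n * m') :
    π.IsSupercuspidal := by
  haveI := Fintype.ofFinite ι
  intro φ hφ w
  -- a uniform depth `n₀` beyond which the coefficient vanishes, in every direction
  have hdir : ∀ α, ∃ n₀ : ℕ, ∀ n : ℕ, n₀ ≤ n → ∀ k₁ ∈ K₀, ∀ m ∈ M, ∀ k₂ ∈ K₀, ∀ z ∈ Subgroup.center G,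
      φ (π (k₁ * (a α ^ n * m) * k₂ * z) w) = 0 := fun α =>
    π.exists_forall_apply_conj_pow_mul_apply_eq_zero hπ (N α) (hker α) (Nf α) (hmono α) (hexh α) (hsmall α) (a α) (hcontr α) M
      (fun m hm j u hu => hdom m hm α j u hu) K₀ hK₀ subset_rfl hφ w
  choose n₀ hn₀ using hdir
  obtain ⟨F, hF, hFM⟩ := hdeep (Finset.univ.sum n₀)
  refine ⟨(K₀ : Set G) * F * (K₀ : Set G), (hK₀.mul hF).mul hK₀, fun g hg => ?_⟩
  rw [Function.mem_support, matrixCoeff_apply] at hg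
  obtain ⟨k₁, hk₁, m, hm, k₂, hk₂, z, hz, rfl⟩ := hcartan g
  rcases hFM m hm with hmF | ⟨α, n, hn, m', hm', rfl⟩
  · exact Set.mem_mul.2 ⟨k₁ * m * k₂, Set.mul_mem_mul (Set.mul_mem_mul hk₁ hmF) hk₂, z, hz, rfl⟩
  · exact absurd (hn₀ α n ((Finset.single_le_sum (f := n₀) (fun _ _ => Nat.zero_le _) (Finset.mem_univ α)).trans hn)
      k₁ hk₁ m' hm' k₂ hk₂ z hz) hg

/-- **The same, in the parabolic-triple currency of ★ `JacquetModule`**: vanishing Jacquet modules `Subsingleton (t_α.restrict π).Coinvariants` along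
finitely many triples `t α` (the maximal proper parabolics), contraction data along each `(t α).N`, a dominant set with Cartan exhaustion and depth ⇒
`π.IsSupercuspidal`. [cite: Casselman1995, Thm. 5.3.1] [cite: BernsteinZelevinsky1976, §3.18–3.21] -/
theorem isSupercuspidal_of_subsingleton_coinvariants_of_cartan_cone (hπ : π.IsSmooth) {ι : Type*} [Finite ι]
    (t : ι → ParabolicTriple G) (hJ : ∀ α, Subsingleton ((t α).restrict π).Coinvariants)
    (Nf : ι → ℤ → Subgroup G) (hmono : ∀ α (j : ℤ), Nf α j ≤ Nf α (j + 1)) (hexh : ∀ α, ∀ u ∈ (t α).N, ∃ j : ℤ, u ∈ Nf α j)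
    (hsmall : ∀ α, ∀ U ∈ nhds (1 : G), ∃ j : ℤ, (Nf α j : Set G) ⊆ U)
    (a : ι → G) (hcontr : ∀ α (j : ℤ), ∀ u ∈ Nf α (j + 1), a α * u * (a α)⁻¹ ∈ Nf α j)
    (M : Set G) (hdom : ∀ m ∈ M, ∀ α (j : ℤ), ∀ u ∈ Nf α j, m * u * m⁻¹ ∈ Nf α j)
    (K₀ : Subgroup G) (hK₀ : IsCompact (K₀ : Set G))
    (hcartan : ∀ g : G, ∃ k₁ ∈ K₀, ∃ m ∈ M, ∃ k₂ ∈ K₀, ∃ z ∈ Subgroup.center G, g = k₁ * m * k₂ * z)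
    (hdeep : ∀ n₀ : ℕ, ∃ F : Set G, IsCompact F ∧
      ∀ m ∈ M, m ∈ F ∨ ∃ α, ∃ n : ℕ, n₀ ≤ n ∧ ∃ m' ∈ M, m = a α ^ n * m') :
    π.IsSupercuspidal :=
  π.isSupercuspidal_of_coinvariantsKer_eq_top_of_cartan_cone hπ (fun α => (t α).N)
    (fun α => by haveI := hJ α; exact π.coinvariantsKer_eq_top_of_subsingleton (t α)) Nf hmono hexh hsmall a hcontr M hdom K₀ hK₀
    hcartan hdeep

/-! ## §3 The cone of monomials `∏_α a_α^{n_α}` in pairwise commuting dominant elements -/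

omit [TopologicalSpace G] [IsTopologicalGroup G] in
/-- Products of LEVEL-PRESERVING elements are level preserving (`Finset.noncommProd_induction`). [cite: Casselman1995, Prop. 1.4.3] -/
theorem _root_.Literature.NumberTheory.Automorphic.noncommProd_conj_mem_of_forall {ι : Type*} (s : Finset ι) (f : ι → G)
    (comm : (s : Set ι).Pairwise (Commute on f))
    (L : Subgroup G) (hf : ∀ i ∈ s, ∀ u ∈ L, f i * u * (f i)⁻¹ ∈ L) :
    ∀ u ∈ L, s.noncommProd f comm * u * (s.noncommProd f comm)⁻¹ ∈ L := by
  refine Finset.noncommProd_induction s f comm (fun g => ∀ u ∈ L, g * u * g⁻¹ ∈ L) (fun x y hx hy u hu => ?_) (fun u hu => by simpa using hu) hf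
  have h := hx _ (hy u hu)
  rwa [show x * (y * u * y⁻¹) * x⁻¹ = x * y * u * (x * y)⁻¹ by group] at h

/-- **HARISH-CHANDRA'S SUPPORT THEOREM OVER THE CONE `{∏_α a_α^{n_α}}`** (Casselman Thm. 5.3.1 as printed, any rank): `π` smooth with vanishing Jacquet
modules along the triples `t α` (`α ∈ ι` finite), contraction data `(Nf α, a α)` with the `a β` pairwise COMMUTING and each `a β` preserving every level
`Nf α j`, a compact `K₀` and the Cartan exhaustion `G = K₀ · {∏_α a_α^{n_α} : n ∈ ℕ^ι} · K₀ · Z(G)` (the product in any fixed order, `Finset.noncommProd`).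
Then `π.IsSupercuspidal`.  (For the unitary groups of Witt index `r`: `ι = Fin r`, `a_i` the Witt cocharacters at a uniformiser; `r = 1` is ★
`isSupercuspidal_of_subsingleton_coinvariants_of_cartan` with ★ `exists_cartan_of_involution`.) [cite: Casselman1995, Thm. 5.3.1]
[cite: BernsteinZelevinsky1976, §3.18–3.21] [cite: HarishChandra1970, Part I §3] -/
theorem isSupercuspidal_of_subsingleton_coinvariants_of_cartan_pi (hπ : π.IsSmooth) {ι : Type*} [Fintype ι] [DecidableEq ι]
    (t : ι → ParabolicTriple G) (hJ : ∀ α, Subsingleton ((t α).restrict π).Coinvariants)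
    (Nf : ι → ℤ → Subgroup G) (hmono : ∀ α (j : ℤ), Nf α j ≤ Nf α (j + 1)) (hexh : ∀ α, ∀ u ∈ (t α).N, ∃ j : ℤ, u ∈ Nf α j)
    (hsmall : ∀ α, ∀ U ∈ nhds (1 : G), ∃ j : ℤ, (Nf α j : Set G) ⊆ U)
    (a : ι → G) (hcomm : ∀ α β, Commute (a α) (a β))
    (hcontr : ∀ α (j : ℤ), ∀ u ∈ Nf α (j + 1), a α * u * (a α)⁻¹ ∈ Nf α j)
    (hpres : ∀ α β (j : ℤ), ∀ u ∈ Nf α j, a β * u * (a β)⁻¹ ∈ Nf α j)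
    (K₀ : Subgroup G) (hK₀ : IsCompact (K₀ : Set G))
    (hcartan : ∀ g : G, ∃ k₁ ∈ K₀, ∃ k₂ ∈ K₀, ∃ n : ι → ℕ, ∃ z ∈ Subgroup.center G,
      g = k₁ * Finset.univ.noncommProd (fun α => a α ^ n α) (fun α _ β _ _ => (hcomm α β).pow_pow (n α) (n β)) * k₂ * z) :
    π.IsSupercuspidal := by
  -- the dominant set: all monomials
  let mono : (ι → ℕ) → G := fun n => Finset.univ.noncommProd (fun α => a α ^ n α) (fun α _ β _ _ => (hcomm α β).pow_pow (n α) (n β))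
  let M : Set G := Set.range mono
  have hdom : ∀ m ∈ M, ∀ α (j : ℤ), ∀ u ∈ Nf α j, m * u * m⁻¹ ∈ Nf α j := by
    rintro _ ⟨n, rfl⟩ α j u hu
    refine noncommProd_conj_mem_of_forall Finset.univ _ _ (Nf α j) (fun β _ v hv => ?_) u hu
    -- `a β ^ n β` preserves `Nf α j`
    induction n β with
    | zero => simpa using hv
    | succ c ih =>
      have h := hpres α β j _ ih
      rwa [show a β * (a β ^ c * v * (a β ^ c)⁻¹) * (a β)⁻¹ = a β ^ (c + 1) * v * (a β ^ (c + 1))⁻¹ by rw [pow_succ']; group] at h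
  refine π.isSupercuspidal_of_subsingleton_coinvariants_of_cartan_cone hπ t hJ Nf hmono hexh hsmall a hcontr M hdom K₀ hK₀
    (fun g => ?_) (fun n₀ => ?_)
  · obtain ⟨k₁, hk₁, k₂, hk₂, n, z, hz, rfl⟩ := hcartan g
    exact ⟨k₁, hk₁, mono n, ⟨n, rfl⟩, k₂, hk₂, z, hz, rfl⟩
  · -- exceptional set: the monomials with all exponents `< n₀` (finitely many)
    have hfin : {n : ι → ℕ | ∀ α, n α < n₀}.Finite := by
      refine (Set.Finite.pi fun _ : ι => Set.finite_Iio n₀).subset fun n hn => ?_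
      exact Set.mem_univ_pi.2 fun α => hn α
    refine ⟨mono '' {n | ∀ α, n α < n₀}, (hfin.image _).isCompact, ?_⟩
    rintro _ ⟨n, rfl⟩
    by_cases h : ∀ α, n α < n₀
    · exact Or.inl ⟨n, h, rfl⟩
    · push Not at h
      obtain ⟨α, hα⟩ := h
      refine Or.inr ⟨α, n α, hα, mono (Function.update n α 0), ⟨_, rfl⟩, ?_⟩
      -- peel the `α`-th factor off the monomial: `∏ a^n = a_α^{n_α} · ∏_{β ≠ α} a_β^{n_β} = a_α^{n_α} · ∏ a^{n[α ↦ 0]}`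
      have h1 := Finset.mul_noncommProd_erase Finset.univ (Finset.mem_univ α) (fun β => a β ^ n β)
        (fun β _ γ _ _ => (hcomm β γ).pow_pow (n β) (n γ))
      have h2 := Finset.mul_noncommProd_erase Finset.univ (Finset.mem_univ α) (fun β => a β ^ Function.update n α 0 β)
        (fun β _ γ _ _ => (hcomm β γ).pow_pow (Function.update n α 0 β) (Function.update n α 0 γ))
      have h3 : (Finset.univ.erase α).noncommProd (fun β => a β ^ Function.update n α 0 β)
            (fun β hβ γ hγ hne => (hcomm β γ).pow_pow (Function.update n α 0 β) (Function.update n α 0 γ)) =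
          (Finset.univ.erase α).noncommProd (fun β => a β ^ n β) (fun β hβ γ hγ hne => (hcomm β γ).pow_pow (n β) (n γ)) :=
        Finset.noncommProd_congr rfl (fun β hβ => by rw [Function.update_of_ne (Finset.ne_of_mem_erase hβ)]) _
      show mono n = a α ^ n α * mono (Function.update n α 0)
      simp only [mono]
      rw [← h1, ← h2, h3, Function.update_self, pow_zero, one_mul]

end Topological

end Representation

end
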